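import Literature.AlgebraicGeometry.KTheory.HuInfinitesimalKZero
import Literature.Algebra.Homology.StupidFiltrationDegeneration
import Mathlib.RingTheory.Flat.Localization
import HarnessLib

/-!
# Torsion of X. Hu's hypercohomology groups and rational bijectivity of `K₀(X_n)_ℚ → K₀(X_m)_ℚ`

Proved companions of the `@[claim]` named facts `KTheory.HuKZeroKernelPresentation` and
`KTheory.HuKZeroLiftingCriterion` (`KTheory/HuInfinitesimalKZero`: X. Hu, arXiv:2507.12458,
Cor. 10.5(i) — the kernel of `K₀(X_n) → K₀(X_m)` is the image of
`⊕_{r=1}^{p-1} ℍ^{2r-1}(X, p^{r,m}_{r,n}Ω•)` — and Thm. 1.2 — a class lifts iff its Hodge obstruction in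
`⊕_{r=1}^{d-1} ℍ^{2r}(X, p^{r,m}_{r,n}Ω•)` vanishes). This file introduces no definitions and no named
facts; everything is proved, the facts entering as hypotheses `(h : …)`.

## Contents

* **Torsion of the carriers.** The `j`-th term of a staircase quotient `K/q^{e}` is killed by
  `q^{e j}` (`zsmul_id_powQuotient_X`) and so is the corresponding term of any staircase image inside
  it (`zsmul_id_powImage_X`); hence every term of Hu's complex `p^{r,M}_{r,N}Ω•`
  (`Crystalline.huComplex`, Def. 8.2 of the source: `p^{(r-j)M}Ωʲ_{X_{(r-j)N}}`) is killed by
  `p^{(r-j)N}`, so by `p^{rN}` (`zsmul_id_huComplex_X`, `zsmul_id_huComplex_X'`), the `ℤ`-indexed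
  complex satisfies `p^{rN} • 𝟙 = 0` (`zsmul_id_huComplexInt`), and — `HyperExt.map` being additive in
  the morphism (`Algebra.Homology.HyperExt.map_zsmul_id`) — **`p^{rn}` kills the hypercohomology
  `ℍⁱ(X, p^{r,m}_{r,n}Ω•)`** (`huH_zsmul_eq_zero`). Consequently the source
  `⊕_{r=1}^{p-1} ℍ^{2r-1}` of Hu's kernel presentation is killed by `p^{(p-1)n}`
  (`HuKernelSource.zsmul_eq_zero`) and the target `⊕_{r=1}^{d-1} ℍ^{2r}` of his Hodge obstruction map
  by `p^{(d-1)n}` (`HuObstructionTarget.zsmul_eq_zero`). This is the tree-carrier form of the remark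
  "the relative `K`-groups `K_i(X_n, X_m)` are `p`-torsion" (arXiv:2507.12458, Rem. 1.3 (ii)) and of
  "the RHS is a `p`-primary group" in the proof of Prop. 11.1 (p. 65).
* **Rational injectivity from a torsion kernel** (`injective_baseChange_rat_of_ker_zsmul`): a
  `ℤ`-linear map whose kernel is killed by a nonzero integer is injective after `ℚ ⊗_ℤ -` (`ℚ` is
  flat over `ℤ`, Mathlib `IsLocalization.flat` + `Module.Flat.lTensor_exact`, and `ℚ ⊗ T = 0` for `T`
  of bounded exponent).
* **Consequences of `HuKZeroKernelPresentation`** (each takes `(h : HuKZeroKernelPresentation)`; for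
  `k` perfect of characteristic `p`, `𝒳/W(k)` a smooth proper model of relative dimension `d`,
  `d + 5 ≤ p`, `1 ≤ m < n`):
  - `HuKZeroKernelPresentation.zsmul_eq_zero_of_map_eq_zero`: the kernel of `K₀(X_n) → K₀(X_m)` is
    killed by `p^{(p-1)n}`;
  - `HuKZeroKernelPresentation.exists_lift_of_map_eq_zero`: kernel-tower lifting along `n ≤ n'` when
    the reduction of the hypercohomology sources is onto (clauses (a)+(b) of the fact; the use
    "(2_K)" named in the module docstring of `KTheory/HuInfinitesimalKZero`);
  - `HuKZeroKernelPresentation.kZeroRat_map_injective` / `eq_zero_of_kZeroRat_map_eq_zero`: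
    **`K₀(X_n)_ℚ → K₀(X_m)_ℚ` is injective** — rationally no class is lost between two thickenings,
    the finite-level input of Bloch–Esnault–Kerz-style arguments on `lim_n K₀(X_n)_ℚ`.
* **Consequences of `HuKZeroLiftingCriterion`** (the sibling fact, Thm. 1.2; `d + 6 ≤ p`):
  - `HuKZeroLiftingCriterion.exists_lift_zsmul`: `p^{(d-1)n} • ξ` lifts to `K₀(X_n)` for EVERY
    `ξ ∈ K₀(X_m)` (the obstruction map is a homomorphism into a group killed by `p^{(d-1)n}`);
  - `HuKZeroLiftingCriterion.kZeroRat_map_surjective`: `K₀(X_n)_ℚ → K₀(X_m)_ℚ` is surjective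
    (`surjective_baseChange_rat_of_forall_exists_zsmul`);
  - with both facts, `kZeroRat_map_thickeningMap_bijective`: **`K₀(X_n)_ℚ → K₀(X_m)_ℚ` is
    bijective** for `1 ≤ m < n` — at finite level the `K₀`-lifting problem is rationally trivial; the
    content of the `p`-adic variational Hodge problem sits in the limit `n → ∞`, where the exponents
    `(d-1)n`, `(p-1)n` are unbounded.

## References

* X. Hu, *On the algebraic `K`-theory of smooth schemes over truncated Witt vectors*,
  arXiv:2507.12458 (2025), Thm. 1.2, Def. 8.2, Cor. 10.5(i), Rem. 1.3 (ii), proof of Prop. 11.1.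
  [`Hu2025TruncatedWitt`]
-/

noncomputable section

open CategoryTheory CategoryTheory.Limits

namespace Literature.AlgebraicGeometry.KTheory

open _root_.AlgebraicGeometry _root_.TopologicalSpace TensorProduct
  Literature.AlgebraicGeometry.Motives Literature.AlgebraicGeometry.Crystalline
  Literature.Algebra.Homology

universe v u

/-! ### Torsion of staircase quotients and images -/

section Staircase

variable {𝒜 : Type u} [Category.{v} 𝒜] [Abelian 𝒜]

/-- The `j`-th term `Kʲ / q^{e j} Kʲ` of a staircase quotient is killed by `q ^ e j`. [folklore] -/
theorem zsmul_id_powQuotient_X (K : CochainComplex 𝒜 ℕ) (q : ℤ) {e : ℕ → ℕ} (he : Antitone e)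
    (j : ℕ) : (q ^ e j : ℤ) • 𝟙 ((powQuotient K q he).X j) = 0 := by
  change (q ^ e j : ℤ) • 𝟙 (cokernel (powSMul K q e j)) = 0
  rw [← cancel_epi (cokernel.π (powSMul K q e j)), comp_zero, Preadditive.comp_zsmul,
    Category.comp_id, ← Category.id_comp (cokernel.π _), ← Preadditive.zsmul_comp]
  exact cokernel.condition _

/-- A term of a staircase image subcomplex `q^{e} Q` is killed by whatever kills the corresponding
term of `Q`. [folklore] -/
theorem zsmul_id_powImage_X (Q : CochainComplex 𝒜 ℕ) (q : ℤ) {e : ℕ → ℕ} (he : Antitone e)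
    (j : ℕ) (c : ℤ) (hc : c • 𝟙 (Q.X j) = 0) : c • 𝟙 ((powImage Q q he).X j) = 0 := by
  change c • 𝟙 (image (powSMul Q q e j)) = 0
  rw [← cancel_mono (image.ι (powSMul Q q e j)), zero_comp, Preadditive.zsmul_comp,
    Category.id_comp, ← Category.comp_id (image.ι _), ← Preadditive.comp_zsmul, hc, comp_zero]

/-- `c • 𝟙 = 0` is invariant under isomorphism. [folklore] -/
theorem zsmul_id_eq_zero_of_iso {Y Z : 𝒜} (e : Y ≅ Z) (c : ℤ) (h : c • 𝟙 Z = 0) :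
    c • 𝟙 Y = 0 := by
  rw [← e.hom_inv_id, ← Category.id_comp e.inv, ← Preadditive.comp_zsmul,
    ← Preadditive.zsmul_comp, h, zero_comp, comp_zero]

/-- A complex all of whose terms are killed by `c` is killed by `c`. [folklore] -/
theorem zsmul_id_eq_zero_of_forall_X {ι : Type*} {c' : ComplexShape ι}
    (K : HomologicalComplex 𝒜 c') (c : ℤ) (h : ∀ i, c • 𝟙 (K.X i) = 0) : c • 𝟙 K = 0 := by
  ext i
  rw [HomologicalComplex.zsmul_f_apply, HomologicalComplex.id_f, HomologicalComplex.zero_f, h]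

end Staircase

/-! ### Torsion of Hu's complexes and of their hypercohomology -/

section HuTorsion

variable {A : Type u} [CommRing A] (X : Over (Spec (CommRingCat.of A))) (q : ℤ)

/-- The `j`-th term `q^{(r-j)M}(Ωʲ/q^{(r-j)N})` of Hu's complex `p^{r,M}_{r,N}Ω•` is killed by
`q^{(r-j)N}`. [folklore] -/
theorem zsmul_id_huComplex_X (r M N j : ℕ) :
    (q ^ ((r - j) * N) : ℤ) • 𝟙 ((huComplex X q r M N).X j) = 0 :=
  zsmul_id_powImage_X _ q _ j _ (zsmul_id_powQuotient_X _ q (antitone_staircase r N) j)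

/-- Every term of Hu's complex `p^{r,M}_{r,N}Ω•` is killed by `q^{rN}`. [folklore] -/
theorem zsmul_id_huComplex_X' (r M N j : ℕ) :
    (q ^ (r * N) : ℤ) • 𝟙 ((huComplex X q r M N).X j) = 0 := by
  rw [← pow_sub_mul_pow q (Nat.mul_le_mul_right N (Nat.sub_le r j)), ← smul_smul,
    zsmul_id_huComplex_X, smul_zero]

/-- Hu's complex `p^{r,M}_{r,N}Ω•` (as a `ℤ`-indexed complex) is killed by `q^{rN}`:
`q^{rN} • 𝟙 = 0`. [folklore] -/
theorem zsmul_id_huComplexInt (r M N : ℕ) :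
    (q ^ (r * N) : ℤ) • 𝟙 (huComplexInt X q r M N) = 0 := by
  refine zsmul_id_eq_zero_of_forall_X _ _ fun i ↦ ?_
  cases i with
  | ofNat j =>
    exact zsmul_id_eq_zero_of_iso
      ((huComplex X q r M N).extendXIso ComplexShape.embeddingUpNat (i := j) rfl) _
      (zsmul_id_huComplex_X' X q r M N j)
  | negSucc j =>
    exact ((huComplex X q r M N).isZero_extend_X ComplexShape.embeddingUpNat _
      (fun l hl ↦ by cases hl)).eq_of_src _ _

variable (p : ℕ) [Fact p.Prime] (k : Type) [CommRing k] (𝒳 : SchemeOver (WittVector p k))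

-- `HasHyperExt ℤ (p^{r,M}_{r,N}Ω•)`: see `HuInfinitesimalKZeroProofs`.
set_option synthInstance.maxHeartbeats 200000 in
/-- **Hu's hypercohomology groups are `p`-power torsion**: `p^{rn}` kills
`ℍⁱ(X, p^{r,m}_{r,n}Ω•)` (every term of the complex is killed by `p^{rn}`). In particular these
groups — the targets of Hu's obstruction maps and the sources of his kernel presentation — vanish
after `⊗ ℚ`. [folklore] -/
theorem huH_zsmul_eq_zero (r m n : ℕ) (i : ℤ) (x : huH p k 𝒳 r m n i) :
    ((p : ℤ) ^ (r * n)) • x = 0 := by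
  rw [← HyperExt.map_zsmul_id, zsmul_id_huComplexInt, HyperExt.map_zero_hom]

variable {p k 𝒳}

/-- The source `⊕_{r=1}^{p-1} ℍ^{2r-1}(p^{r,m}_{r,n}Ω•)` of Hu's kernel presentation is killed by
`p^{(p-1)n}`. [folklore] -/
theorem HuKernelSource.zsmul_eq_zero (m n : ℕ) (x : HuKernelSource p k 𝒳 m n) :
    ((p : ℤ) ^ ((p - 1) * n)) • x = 0 := by
  funext r
  obtain ⟨r, h1, hr⟩ := r
  have hle : r * n ≤ (p - 1) * n := Nat.mul_le_mul_right n (by omega)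
  change ((p : ℤ) ^ ((p - 1) * n)) • x ⟨r, h1, hr⟩ = 0
  rw [← pow_sub_mul_pow (p : ℤ) hle, ← smul_smul, huH_zsmul_eq_zero, smul_zero]

/-- The target `⊕_{r=1}^{d-1} ℍ^{2r}(p^{r,m}_{r,n}Ω•)` of Hu's Hodge obstruction map is killed by
`p^{(d-1)n}`. [folklore] -/
theorem HuObstructionTarget.zsmul_eq_zero (d m n : ℕ) (x : HuObstructionTarget p k 𝒳 d m n) :
    ((p : ℤ) ^ ((d - 1) * n)) • x = 0 := by
  funext r
  obtain ⟨r, h1, hr⟩ := r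
  have hle : r * n ≤ (d - 1) * n := Nat.mul_le_mul_right n (by omega)
  change ((p : ℤ) ^ ((d - 1) * n)) • x ⟨r, h1, hr⟩ = 0
  rw [← pow_sub_mul_pow (p : ℤ) hle, ← smul_smul, huH_zsmul_eq_zero, smul_zero]

end HuTorsion

/-! ### Rational injectivity from a torsion kernel -/

section Rational

/-- A `ℤ`-linear map whose kernel is killed by a nonzero integer becomes injective after `ℚ ⊗ -`
(`ℚ` is flat over `ℤ` and `ℚ ⊗ T = 0` for `T` of bounded exponent). [folklore] -/
theorem injective_baseChange_rat_of_ker_zsmul {M N : Type*} [AddCommGroup M] [AddCommGroup N]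
    (g : M →ₗ[ℤ] N) (c : ℤ) (hc : c ≠ 0) (hg : ∀ x, g x = 0 → c • x = 0) :
    Function.Injective (g.baseChange ℚ) := by
  haveI : Module.Flat ℤ ℚ := IsLocalization.flat ℚ (nonZeroDivisors ℤ)
  rw [LinearMap.baseChange_eq_ltensor]
  have hex := Module.Flat.lTensor_exact ℚ (LinearMap.exact_subtype_ker_map g)
  have hzero : ∀ w : ℚ ⊗[ℤ] (LinearMap.ker g), w = 0 := by
    intro w
    induction w using TensorProduct.induction_on with
    | zero => rfl
    | tmul a y =>
      have hy : c • y = 0 := Subtype.ext (hg y y.2)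
      have hc' : (c : ℚ) ≠ 0 := Int.cast_ne_zero.mpr hc
      calc a ⊗ₜ[ℤ] y = (c • (a / c)) ⊗ₜ[ℤ] y := by rw [zsmul_eq_mul, mul_div_cancel₀ a hc']
        _ = (a / c) ⊗ₜ[ℤ] (c • y) := TensorProduct.smul_tmul _ _ _
        _ = 0 := by rw [hy, TensorProduct.tmul_zero]
    | add w₁ w₂ h₁ h₂ => rw [h₁, h₂, add_zero]
  intro z₁ z₂ hz
  rw [← sub_eq_zero] at hz ⊢
  rw [← map_sub] at hz
  obtain ⟨w, hw⟩ := (hex _).mp hz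
  rw [← hw, hzero w, map_zero]

/-- A `ℤ`-linear map such that a fixed nonzero multiple of every element of the target is a value
becomes surjective after `ℚ ⊗ -`. [folklore] -/
theorem surjective_baseChange_rat_of_forall_exists_zsmul {M N : Type*} [AddCommGroup M]
    [AddCommGroup N] (g : M →ₗ[ℤ] N) (c : ℤ) (hc : c ≠ 0) (hg : ∀ y, ∃ x, g x = c • y) :
    Function.Surjective (g.baseChange ℚ) := by
  have hc' : (c : ℚ) ≠ 0 := Int.cast_ne_zero.mpr hc
  intro z
  induction z using TensorProduct.induction_on with
  | zero => exact ⟨0, map_zero _⟩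
  | tmul a y =>
    obtain ⟨x, hx⟩ := hg y
    refine ⟨(a / c) ⊗ₜ[ℤ] x, ?_⟩
    rw [LinearMap.baseChange_tmul, hx, ← TensorProduct.smul_tmul, zsmul_eq_mul,
      mul_div_cancel₀ a hc']
  | add z₁ z₂ h₁ h₂ =>
    obtain ⟨w₁, rfl⟩ := h₁
    obtain ⟨w₂, rfl⟩ := h₂
    exact ⟨w₁ + w₂, map_add _ _ _⟩

end Rational

/-! ### Consequences of Hu's kernel presentation -/

section Consequences

open WittScheme

/-- **The kernel of `K₀(X_n) → K₀(X_m)` is `p`-power torsion** (granted Hu's kernel presentation):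
for `1 ≤ m < n` and `d + 5 ≤ p`, a class of `K₀(X_n)` restricting to `0` in `K₀(X_m)` is killed by
`p^{(p-1)n}` (it is the image of an element of `⊕_{r=1}^{p-1} ℍ^{2r-1}(p^{r,m}_{r,n}Ω•)`, killed by
`p^{(p-1)n}`, `HuKernelSource.zsmul_eq_zero`). Cf. X. Hu, arXiv:2507.12458, Rem. 1.3 (ii): "the
relative `K`-groups `K_i(X_n, X_m)` are `p`-torsion". [folklore] -/
theorem HuKZeroKernelPresentation.zsmul_eq_zero_of_map_eq_zero (h : HuKZeroKernelPresentation)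
    (p : ℕ) [Fact p.Prime] (k : Type) [Field k] [CharP k p] [PerfectRing k p] (d : ℕ)
    (𝒳 : SchemeOver (WittVector p k)) (h𝒳 : IsSmoothProperModel d 𝒳)
    (hp : d + 5 ≤ p) {m n : ℕ} (hm : 1 ≤ m) (hmn : m < n) (η : KZero (thickening 𝒳 n).left)
    (hη : KZero.map (thickeningMap 𝒳 hmn.le) η = 0) : ((p : ℤ) ^ ((p - 1) * n)) • η = 0 := by
  obtain ⟨ρ, hρ, -⟩ := h p k d 𝒳 h𝒳 hp
  obtain ⟨x, rfl⟩ := (hρ m n hmn hm η).mp hη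
  rw [← map_zsmul, HuKernelSource.zsmul_eq_zero, map_zero]

/-- **Kernel-tower lifting** (granted Hu's kernel presentation): for `1 ≤ m < n ≤ n'` and
`d + 5 ≤ p`, if the reduction `⊕ ℍ^{2r-1}(p^{r,m}_{r,n'}Ω•) → ⊕ ℍ^{2r-1}(p^{r,m}_{r,n}Ω•)` is onto,
then every class of `K₀(X_n)` dying in `K₀(X_m)` is the restriction of a class of `K₀(X_{n'})` dying
in `K₀(X_m)` (clauses (a) and (b) of the fact). This is the use "(2_K) kernel-tower surjectivity"
recorded in the module docstring of `KTheory/HuInfinitesimalKZero`. [folklore] -/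
theorem HuKZeroKernelPresentation.exists_lift_of_map_eq_zero (h : HuKZeroKernelPresentation)
    (p : ℕ) [Fact p.Prime] (k : Type) [Field k] [CharP k p] [PerfectRing k p] (d : ℕ)
    (𝒳 : SchemeOver (WittVector p k)) (h𝒳 : IsSmoothProperModel d 𝒳)
    (hp : d + 5 ≤ p) {m n n' : ℕ} (hm : 1 ≤ m) (hmn : m < n) (hnn' : n ≤ n')
    (hsurj : Function.Surjective (HuKernelSource.reduce (p := p) (k := k) (𝒳 := 𝒳) m hnn'))
    (η : KZero (thickening 𝒳 n).left) (hη : KZero.map (thickeningMap 𝒳 hmn.le) η = 0) :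
    ∃ η' : KZero (thickening 𝒳 n').left,
      KZero.map (thickeningMap 𝒳 (hmn.trans_le hnn').le) η' = 0 ∧
        KZero.map (thickeningMap 𝒳 hnn') η' = η := by
  obtain ⟨ρ, hρ, hρ'⟩ := h p k d 𝒳 h𝒳 hp
  obtain ⟨x, rfl⟩ := (hρ m n hmn hm η).mp hη
  obtain ⟨x', rfl⟩ := hsurj x
  exact ⟨ρ m n' x', (hρ m n' (hmn.trans_le hnn') hm _).mpr ⟨x', rfl⟩, hρ' m n n' hm hmn hnn' x'⟩

/-- **Rational injectivity of restriction** (granted Hu's kernel presentation): for `1 ≤ m < n` and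
`d + 5 ≤ p`, the restriction `K₀(X_n)_ℚ → K₀(X_m)_ℚ` (`KZeroRat.map`) is injective — the kernel of
`K₀(X_n) → K₀(X_m)` is `p`-power torsion (`zsmul_eq_zero_of_map_eq_zero`) and `ℚ` is flat over `ℤ`.
In Bloch–Esnault–Kerz-style arguments on `lim_n K₀(X_n)_ℚ` this says that rationally nothing is lost
between two thickenings. [folklore] -/
theorem HuKZeroKernelPresentation.kZeroRat_map_injective (h : HuKZeroKernelPresentation)
    (p : ℕ) [Fact p.Prime] (k : Type) [Field k] [CharP k p] [PerfectRing k p] (d : ℕ)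
    (𝒳 : SchemeOver (WittVector p k)) (h𝒳 : IsSmoothProperModel d 𝒳)
    (hp : d + 5 ≤ p) {m n : ℕ} (hm : 1 ≤ m) (hmn : m < n) :
    Function.Injective (KZeroRat.map (thickeningMap 𝒳 hmn.le)) :=
  injective_baseChange_rat_of_ker_zsmul (KZero.map (thickeningMap 𝒳 hmn.le)).toIntLinearMap
    ((p : ℤ) ^ ((p - 1) * n)) (pow_ne_zero _ (Int.natCast_ne_zero.mpr (Fact.out : p.Prime).ne_zero))
    fun η hη ↦ h.zsmul_eq_zero_of_map_eq_zero p k d 𝒳 h𝒳 hp hm hmn η hη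

/-- Equivalently: for `1 ≤ m < n`, a rational class `ξ ∈ K₀(X_n)_ℚ` with `ξ|_{X_m} = 0` is zero.
[folklore] -/
theorem HuKZeroKernelPresentation.eq_zero_of_kZeroRat_map_eq_zero (h : HuKZeroKernelPresentation)
    (p : ℕ) [Fact p.Prime] (k : Type) [Field k] [CharP k p] [PerfectRing k p] (d : ℕ)
    (𝒳 : SchemeOver (WittVector p k)) (h𝒳 : IsSmoothProperModel d 𝒳)
    (hp : d + 5 ≤ p) {m n : ℕ} (hm : 1 ≤ m) (hmn : m < n) (ξ : KZeroRat (thickening 𝒳 n).left)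
    (hξ : KZeroRat.map (thickeningMap 𝒳 hmn.le) ξ = 0) : ξ = 0 :=
  h.kZeroRat_map_injective p k d 𝒳 h𝒳 hp hm hmn (hξ.trans (map_zero _).symm)

/-- **A `p`-power multiple of every class lifts** (granted Hu's lifting criterion): for
`1 ≤ m < n` and `d + 6 ≤ p`, `p^{(d-1)n} • ξ` is the restriction of a class of `K₀(X_n)` for every
`ξ ∈ K₀(X_m)` — the Hodge obstruction map is a homomorphism into `⊕_{r=1}^{d-1} ℍ^{2r}(p^{r,m}_{r,n}Ω•)`,
a group killed by `p^{(d-1)n}` (`HuObstructionTarget.zsmul_eq_zero`). [folklore] -/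
theorem HuKZeroLiftingCriterion.exists_lift_zsmul (h : HuKZeroLiftingCriterion)
    (p : ℕ) [Fact p.Prime] (k : Type) [Field k] [CharP k p] [PerfectRing k p] (d : ℕ)
    (𝒳 : SchemeOver (WittVector p k)) (h𝒳 : IsSmoothProperModel d 𝒳)
    (hp : d + 6 ≤ p) {m n : ℕ} (hm : 1 ≤ m) (hmn : m < n) (ξ : KZero (thickening 𝒳 m).left) :
    ∃ ξ' : KZero (thickening 𝒳 n).left,
      KZero.map (thickeningMap 𝒳 hmn.le) ξ' = ((p : ℤ) ^ ((d - 1) * n)) • ξ := by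
  obtain ⟨ob, hob, -⟩ := h p k d 𝒳 h𝒳 hp
  exact (hob m n hmn hm _).mpr (by rw [map_zsmul, HuObstructionTarget.zsmul_eq_zero])

/-- **Rational surjectivity of restriction** (granted Hu's lifting criterion): for `1 ≤ m < n` and
`d + 6 ≤ p`, the restriction `K₀(X_n)_ℚ → K₀(X_m)_ℚ` is surjective — rationally every class lifts
through any finite number of thickenings (`exists_lift_zsmul`); the content of the `p`-adic
variational Hodge problem is in the limit `n → ∞`, where the exponents `(d-1)n` are unbounded.
[folklore] -/
theorem HuKZeroLiftingCriterion.kZeroRat_map_surjective (h : HuKZeroLiftingCriterion)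
    (p : ℕ) [Fact p.Prime] (k : Type) [Field k] [CharP k p] [PerfectRing k p] (d : ℕ)
    (𝒳 : SchemeOver (WittVector p k)) (h𝒳 : IsSmoothProperModel d 𝒳)
    (hp : d + 6 ≤ p) {m n : ℕ} (hm : 1 ≤ m) (hmn : m < n) :
    Function.Surjective (KZeroRat.map (thickeningMap 𝒳 hmn.le)) :=
  surjective_baseChange_rat_of_forall_exists_zsmul (KZero.map (thickeningMap 𝒳 hmn.le)).toIntLinearMap
    ((p : ℤ) ^ ((d - 1) * n)) (pow_ne_zero _ (Int.natCast_ne_zero.mpr (Fact.out : p.Prime).ne_zero))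
    fun ξ ↦ h.exists_lift_zsmul p k d 𝒳 h𝒳 hp hm hmn ξ

/-- **Rational rigidity of `K₀` along the thickening tower** (granted both of Hu's statements): for
`k` perfect of characteristic `p`, `𝒳/W(k)` a smooth proper model of relative dimension `d` with
`d + 6 ≤ p`, and `1 ≤ m < n`, the restriction `K₀(X_n)_ℚ → K₀(X_m)_ℚ` is bijective
(`HuKZeroKernelPresentation.kZeroRat_map_injective`, `HuKZeroLiftingCriterion.kZeroRat_map_surjective`).
[folklore] -/
theorem kZeroRat_map_thickeningMap_bijective (h₁ : HuKZeroLiftingCriterion)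
    (h₂ : HuKZeroKernelPresentation) (p : ℕ) [Fact p.Prime] (k : Type) [Field k] [CharP k p]
    [PerfectRing k p] (d : ℕ) (𝒳 : SchemeOver (WittVector p k)) (h𝒳 : IsSmoothProperModel d 𝒳)
    (hp : d + 6 ≤ p) {m n : ℕ} (hm : 1 ≤ m) (hmn : m < n) :
    Function.Bijective (KZeroRat.map (thickeningMap 𝒳 hmn.le)) :=
  ⟨h₂.kZeroRat_map_injective p k d 𝒳 h𝒳 (by omega) hm hmn,
    h₁.kZeroRat_map_surjective p k d 𝒳 h𝒳 hp hm hmn⟩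

end Consequences

end Literature.AlgebraicGeometry.KTheory

end
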